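import Summits.AtomisticToContinuum.BoseEinsteinCondensation.Theses.BECBoundaryReservoir

/-!
# `ShellPenetration` split glue (route BECBoundaryReservoir, crux stmt-AtomisticToContinuum-8767)

Strategist decomposition of the rank-2 crux `ShellPenetration` into three children (filed by
`ledger route edit --split ShellPenetration`): a case split IDEAL / INTERACTING on the Lebesgue
measure of `{r > 0 | v r ≠ 0}` — `IsRepulsiveFiniteRange` admits `v = 0` a.e. on `(0, ∞)` (the
ideal gas), where the crux survives only at the resonant pinning `κ = 3/w²` (refuter stamps g44-2,
g45-36, rattack-8767-0 on the item) — followed by ONE cut of the interacting piece at the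
shell-density window (the variational half):

1. `IdealShellResonance` — the crux verbatim under `volume {r > 0 | v r ≠ 0} = 0`;
2. `InteractingShellWindow` — interacting `v`: the pinning fills the shell at bounded density,
   `θ|S_w| ≤ ⟨g, γ_Ψ g⟩ ≤ Θ|S_w|` for the near-minimisers, eventually (`|S_w| = L³ − (L − 2w)³`);
3. `InteractingWindowPenetration` — interacting `v`, every window: windowed near-minimisers carry
   coherence `c ⟨g, γ_Ψ g⟩ ≤ |⟨1_{B(z,1)}, γ_Ψ g⟩|²` to every admissible unit ball.

The theorem below is the glue `1 → 2 → 3 → ShellPenetration` with the three child statements as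
verbatim hypotheses (pure logic plus `(L − 2w)³ < L³`); it concludes the crux decl BY NAME.
-/

noncomputable section

namespace Summit.AtomisticToContinuum.BoseEinsteinCondensation.Theorems

open MeasureTheory Filter
open scoped ENNReal NNReal ComplexConjugate
open Summit.AtomisticToContinuum.BoseEinsteinCondensation.Theses.BECBoundaryReservoir
open Literature.MathematicalPhysics.QuantumManyBody.BoseGas

/-- **Split glue for `ShellPenetration`.** `IdealShellResonance → InteractingShellWindow →
InteractingWindowPenetration → ShellPenetration` (children stated verbatim as hypotheses):
case split on `volume {r > 0 | v r ≠ 0} = 0`; the ideal case is the first hypothesis; otherwise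
`ρ₀ := min ρ₀ᵂ ρ₀ᴾ`, the window hypothesis supplies `(w, κ, θ, Θ)` and the eventual window, the
penetration hypothesis (fed the window) supplies `c` and eventual penetration, and the window's
floor with `0 < θ (L³ − (L − 2w)³)` gives `0 < ⟨g, γ_Ψ g⟩` at slack `min δ δ'`. [folklore] -/
theorem ShellPenetration_of_subs
    (h₁ : ∀ v : ℝ → ENNReal, Literature.MathematicalPhysics.QuantumManyBody.BoseGas.IsRepulsiveFiniteRange v → MeasureTheory.volume {r : ℝ | 0 < r ∧ v r ≠ 0} = 0 → ∃ ρ₀ : ℝ, 0 < ρ₀ ∧ ∀ ρ : ℝ, 0 < ρ → ρ < ρ₀ → ∃ w κ c : ℝ, 0 < w ∧ 0 < κ ∧ 0 < c ∧ ∀ᶠ n : ℕ in Filter.atTop, ∃ δ : ENNReal, 0 < δ ∧ let L : ℝ := Literature.MathematicalPhysics.QuantumManyBody.BoseGas.sideLength ρ (n + 1); let g : EuclideanSpace ℝ (Fin 3) → ℂ := Set.indicator {x | (∀ k, x k ∈ Set.Ioo 0 L) ∧ ∃ k, x k ≤ w ∨ L - w ≤ x k} (fun _ => ((Real.sqrt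 (L ^ 3 - (L - 2 * w) ^ 3))⁻¹ : ℂ)); ∀ Ψ : Literature.MathematicalPhysics.QuantumManyBody.BoseGas.TrialState (n + 1) L, Literature.MathematicalPhysics.QuantumManyBody.BoseGas.energy v Ψ + ENNReal.ofReal κ * ((n + 1 : ENNReal) - Literature.MathematicalPhysics.QuantumManyBody.BoseGas.occupation (n + 1) g Ψ.ψ) ≤ (⨅ Φ : Literature.MathematicalPhysics.QuantumManyBody.BoseGas.TrialState (n + 1) L, Literature.MathematicalPhysics.QuantumManyBody.BoseGas.energy v Φ + ENNReal.ofReal κ * ((n + 1 : ENNReal) - Literature.MathematicalPhysics.QuantumManyBody.BoseGas.occupation (n + 1) g Φ.ψ)) + δ → 0 < Literature.MathematicalPhysics.QuantumManyBody.BoseGas.occupation (n + 1) g Ψ.ψ ∧ ∀ z : EuclideanSpace ℝ (Fin 3), (∀ k, z k ∈ Set.Icc (2 * w + 1) (L - 2 * w - 1)) → c * (Literature.MathematicalPhysics.QuantumManyBody.BoseGas.occupation (n + 1) g Ψ.ψ).toReal ≤ ‖(n + 1 : ℂ) * ∫ Y : Fin n → EuclideanSpace ℝ (Fin 3), (∫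 x in Metric.ball z 1, Ψ.ψ (Matrix.vecCons x Y)) * conj (∫ x, conj (g x) * Ψ.ψ (Matrix.vecCons x Y))‖ ^ 2)
    (h₂ : ∀ v : ℝ → ENNReal, Literature.MathematicalPhysics.QuantumManyBody.BoseGas.IsRepulsiveFiniteRange v → MeasureTheory.volume {r : ℝ | 0 < r ∧ v r ≠ 0} ≠ 0 → ∃ ρ₀ : ℝ, 0 < ρ₀ ∧ ∀ ρ : ℝ, 0 < ρ → ρ < ρ₀ → ∃ w κ θ Θ : ℝ, 0 < w ∧ 0 < κ ∧ 0 < θ ∧ ∀ᶠ n : ℕ in Filter.atTop, ∃ δ : ENNReal, 0 < δ ∧ let L : ℝ := Literature.MathematicalPhysics.QuantumManyBody.BoseGas.sideLength ρ (n + 1); let g : EuclideanSpace ℝ (Fin 3) → ℂ := Set.indicator {x | (∀ k, x k ∈ Set.Ioo 0 L) ∧ ∃ k, x k ≤ w ∨ L - w ≤ x k} (fun _ => ((Real.sqrt (L ^ 3 - (L - 2 * w) ^ 3))⁻¹ : ℂ)); ∀ Ψ : Literature.MathematicalPhysics.QuantumManyBody.BoseGas.TrialState (n + 1) L, Literature.MathematicalPhysics.QuantumManyBody.BoseGas.energy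 v Ψ + ENNReal.ofReal κ * ((n + 1 : ENNReal) - Literature.MathematicalPhysics.QuantumManyBody.BoseGas.occupation (n + 1) g Ψ.ψ) ≤ (⨅ Φ : Literature.MathematicalPhysics.QuantumManyBody.BoseGas.TrialState (n + 1) L, Literature.MathematicalPhysics.QuantumManyBody.BoseGas.energy v Φ + ENNReal.ofReal κ * ((n + 1 : ENNReal) - Literature.MathematicalPhysics.QuantumManyBody.BoseGas.occupation (n + 1) g Φ.ψ)) + δ → ENNReal.ofReal (θ * (L ^ 3 - (L - 2 * w) ^ 3)) ≤ Literature.MathematicalPhysics.QuantumManyBody.BoseGas.occupation (n + 1) g Ψ.ψ ∧ Literature.MathematicalPhysics.QuantumManyBody.BoseGas.occupation (n + 1) g Ψ.ψ ≤ ENNReal.ofReal (Θ * (L ^ 3 - (L - 2 * w) ^ 3)))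
    (h₃ : ∀ v : ℝ → ENNReal, Literature.MathematicalPhysics.QuantumManyBody.BoseGas.IsRepulsiveFiniteRange v → MeasureTheory.volume {r : ℝ | 0 < r ∧ v r ≠ 0} ≠ 0 → ∃ ρ₀ : ℝ, 0 < ρ₀ ∧ ∀ ρ : ℝ, 0 < ρ → ρ < ρ₀ → ∀ w κ θ Θ : ℝ, 0 < w → 0 < κ → 0 < θ → (∀ᶠ n : ℕ in Filter.atTop, ∃ δ : ENNReal, 0 < δ ∧ let L : ℝ := Literature.MathematicalPhysics.QuantumManyBody.BoseGas.sideLength ρ (n + 1); let g : EuclideanSpace ℝ (Fin 3) → ℂ := Set.indicator {x | (∀ k, x k ∈ Set.Ioo 0 L) ∧ ∃ k, x k ≤ w ∨ L - w ≤ x k} (fun _ => ((Real.sqrt (L ^ 3 - (L - 2 * w) ^ 3))⁻¹ : ℂ)); ∀ Ψ : Literature.MathematicalPhysics.QuantumManyBody.BoseGas.TrialState (n + 1) L, Literature.MathematicalPhysics.QuantumManyBody.BoseGas.energy v Ψ + ENNReal.ofReal κ * ((n + 1 : ENNReal) - Literature.MathematicalPhysics.QuantumManyBody.BoseGas.occupation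 (n + 1) g Ψ.ψ) ≤ (⨅ Φ : Literature.MathematicalPhysics.QuantumManyBody.BoseGas.TrialState (n + 1) L, Literature.MathematicalPhysics.QuantumManyBody.BoseGas.energy v Φ + ENNReal.ofReal κ * ((n + 1 : ENNReal) - Literature.MathematicalPhysics.QuantumManyBody.BoseGas.occupation (n + 1) g Φ.ψ)) + δ → ENNReal.ofReal (θ * (L ^ 3 - (L - 2 * w) ^ 3)) ≤ Literature.MathematicalPhysics.QuantumManyBody.BoseGas.occupation (n + 1) g Ψ.ψ ∧ Literature.MathematicalPhysics.QuantumManyBody.BoseGas.occupation (n + 1) g Ψ.ψ ≤ ENNReal.ofReal (Θ * (L ^ 3 - (L - 2 * w) ^ 3))) → ∃ c : ℝ, 0 < c ∧ ∀ᶠ n : ℕ in Filter.atTop, ∃ δ : ENNReal, 0 < δ ∧ let L : ℝ := Literature.MathematicalPhysics.QuantumManyBody.BoseGas.sideLength ρ (n + 1); let g : EuclideanSpace ℝ (Fin 3) → ℂ := Set.indicator {x | (∀ k, x k ∈ Set.Ioo 0 L) ∧ ∃ k, x k ≤ w ∨ L - w ≤ x k} (fun _ => ((Real.sqrt (L ^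 3 - (L - 2 * w) ^ 3))⁻¹ : ℂ)); ∀ Ψ : Literature.MathematicalPhysics.QuantumManyBody.BoseGas.TrialState (n + 1) L, Literature.MathematicalPhysics.QuantumManyBody.BoseGas.energy v Ψ + ENNReal.ofReal κ * ((n + 1 : ENNReal) - Literature.MathematicalPhysics.QuantumManyBody.BoseGas.occupation (n + 1) g Ψ.ψ) ≤ (⨅ Φ : Literature.MathematicalPhysics.QuantumManyBody.BoseGas.TrialState (n + 1) L, Literature.MathematicalPhysics.QuantumManyBody.BoseGas.energy v Φ + ENNReal.ofReal κ * ((n + 1 : ENNReal) - Literature.MathematicalPhysics.QuantumManyBody.BoseGas.occupation (n + 1) g Φ.ψ)) + δ → ∀ z : EuclideanSpace ℝ (Fin 3), (∀ k, z k ∈ Set.Icc (2 * w + 1) (L - 2 * w - 1)) → c * (Literature.MathematicalPhysics.QuantumManyBody.BoseGas.occupation (n + 1) g Ψ.ψ).toReal ≤ ‖(n + 1 : ℂ) * ∫ Y : Fin n → EuclideanSpace ℝ (Fin 3), (∫ x in Metric.ball z 1, Ψ.ψ (Matrix.vecCons x Y)) * conj (∫ x, conj (g x) * Ψ.ψ (Matrix.vecCons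 x Y))‖ ^ 2) :
    ShellPenetration := by
  intro v hv
  by_cases hid : MeasureTheory.volume {r : ℝ | 0 < r ∧ v r ≠ 0} = 0
  · exact h₁ v hv hid
  obtain ⟨ρW, hρW, hW⟩ := h₂ v hv hid
  obtain ⟨ρP, hρP, hP⟩ := h₃ v hv hid
  refine ⟨min ρW ρP, lt_min hρW hρP, fun ρ hρ hρlt => ?_⟩
  have hρltW : ρ < ρW := hρlt.trans_le (min_le_left _ _)
  have hρltP : ρ < ρP := hρlt.trans_le (min_le_right _ _)
  -- The window, with its parameters.
  obtain ⟨w, κ, θ, Θ, hw, hκ, hθ, hevW⟩ := hW ρ hρ hρltW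
  -- Penetration, fed the window.
  obtain ⟨c, hc, hevP⟩ := hP ρ hρ hρltP w κ θ Θ hw hκ hθ hevW
  refine ⟨w, κ, c, hw, hκ, hc, ?_⟩
  -- Positivity of the shell volume `L³ − (L − 2w)³`.
  have hvol : ∀ L : ℝ, 0 < θ * (L ^ 3 - (L - 2 * w) ^ 3) := by
    intro L
    have hlt : (L - 2 * w) ^ 3 < L ^ 3 :=
      Odd.strictMono_pow (by decide : Odd 3) (by linarith : L - 2 * w < L)
    exact mul_pos hθ (sub_pos.mpr hlt)
  filter_upwards [hevW, hevP] with n hnW hnP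
  obtain ⟨δW, hδW, hnW⟩ := hnW
  obtain ⟨δP, hδP, hnP⟩ := hnP
  refine ⟨min δW δP, lt_min hδW hδP, ?_⟩
  intro L g Ψ hΨ
  have hΨW := hΨ.trans (add_le_add le_rfl (min_le_left δW δP))
  have hΨP := hΨ.trans (add_le_add le_rfl (min_le_right δW δP))
  obtain ⟨hlo, -⟩ := hnW Ψ hΨW
  refine ⟨lt_of_lt_of_le (ENNReal.ofReal_pos.mpr (hvol L)) hlo, ?_⟩
  exact hnP Ψ hΨP

end Summit.AtomisticToContinuum.BoseEinsteinCondensation.Theorems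

end
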